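import Summits.ResolutionOfSingularities.ResolutionOfSingularities.Theorems.EquisingularLiftEquisingularLiftNatHyperplaneLetterThroughSection
import Summits.ResolutionOfSingularities.ResolutionOfSingularities.Theorems.EquisingularLiftEquisingularLiftNatSaturatedLift
import HarnessLib

/-!
# [OURS · L1 W4.5(b) · EL♮(3) · D5 HOPEN, (IN-1) JOINT BIRTH, brick (B5)] THE GAUGE MEMBERSHIP UPSTAIRS — ★ `KeyForm.keyModel_le_gauge`:
# `(G̃)~ ≤ 𝓛h^α ⊔ 𝓛h · (ker s)^α ⊔ (ker s)^α · 𝓛j` from the polynomial membership `G̃ ∈ (Lh^α) + (Lh)·𝔓^α + 𝔓^α·(Lj)`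

res-type-027 g21 (TAKING-UNLESS-OBJECTED 2026-08-28T22:46Z on desk R59's brick list; statement VERBATIM from res-L1-w45b-stub-4 g12's interface file
`L/res-L1-w45b-stub-4/KeyFormSIG.lean` 6e4862d4abec49c6, brick (B5) of the split of (IN-1) `hBirth` of ✓ `TCPlus.opening_pointPhase` /
✓ `TCPlus.hopen_supplier_of₂`). Crux `EquisingularLiftNatThree` = stmt-ResolutionOfSingularities-20148 (parent stmt-…-20038), route `EquisingularLift`,
line `sections`. OURS; NOT a statement of any manuscript ([Hironaka2017] is a candidate under adjudication, nothing of it is asserted); AI-written,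
weaker than expert review. No `sorry`, no definition, no instance; standard axioms. `--supports stmt-ResolutionOfSingularities-20148 --as helper`.

WHAT. `O` a DVR, `ℙ_O = Proj O[x₀,…,x_{r+1}]`, a section `s` of `q : ℙ_O → Spec O` lying in the chart `D₊(x_{i₀})` with coordinate homomorphism `Φ`
and coordinates `a_j = Φ(x_j/x_{i₀})` (`a_{i₀} = 1`; res-type-027 g19's `LeKer` context of …NatHyperplaneLetterThroughSection), the section's
homogeneous ideal `𝔓 = (x_j − a_j x_{i₀})_j`, two letters `V₊(Lh)`, `V₊(Lj)` carried as `ker (Proj f)` with `ker f = (L)` (part 3 currency), and a form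
`G̃ ∈ O[x]_e` with `G̃ ∈ (Lh^α) + (Lh)·𝔓^α + 𝔓^α·(Lj)`. THEN the key model satisfies `(G̃)~ ≤ 𝓛h^α ⊔ 𝓛h·(ker s)^α ⊔ (ker s)^α·𝓛j`.
Route (chartwise on the standard cover, Mathlib `Scheme.IdealSheafData.le_of_iSup_eq_top`):
* §1 the DEHOMOGENISATION RING HOMOMORPHISM `Dᵢ : O[x] → Γ(ℙ_O, D₊(xᵢ))`, `F ↦ F(x/xᵢ)` (Literature `Segre.awayMk_eq_eval₂`): on forms
  `Dᵢ F = awayToSection (F / xᵢ^d)`; hence the chart ideals of `(G̃)~` and of the letters are `(Dᵢ G̃)`, `(Dᵢ L)` (tree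
  `projIdealSheaf_ideal_basicOpen_span`, res-type-027 g19's ✓ `LinearLetter.ideal_ker_basicOpen_eq_span`);
* §2 the POINT GENERATORS LIE IN THE SECTION'S KERNEL ON EVERY CHART: `𝔓~ ≤ ker s` — checked once, on the chart `D₊(x_{i₀})` containing the section,
  by the comap criterion of ✓ `LinearLetter.ker_projMap_le_ker_of_eval_eq_zero` (`(x_j − a_j x_{i₀})(a) = a_j − a_j·1 = 0`), then `ideal` is monotone;
* §3 push the polynomial membership through `Dᵢ` (`Ideal.map_sup/mul/pow/span`) and compare summand by summand.

References: [Hartshorne1977, II Prop. 2.5, Prop. 5.9, Ex. 3.12]; tree kit (OURS, imported): …NatHyperplaneLetterThroughSection (res-type-027 g19),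
…NatSaturatedLift, …NatCompleteIntersectionLiftProj; Literature `Motives/SegreEmbedding`, `Resolution/ProjHomogeneousIdealSheaf`, `Resolution/MarkedIdealsLemmas`.
-/

set_option linter.dupNamespace false -- mandated namespace `Summit.<Summit>.<Problem>` of this single-conjunct summit
set_option linter.overlappingInstances false -- signatures carry `[IsDomain O] [IsDiscreteValuationRing O]`

noncomputable section

open CategoryTheory AlgebraicGeometry TopologicalSpace Opposite IsLocalRing
open MvPolynomial HomogeneousLocalization
open Literature.AlgebraicGeometry.Resolution
open Literature.AlgebraicGeometry.Motives Literature.AlgebraicGeometry.Motives.Segre Literature.AlgebraicGeometry.Motives.GeneratingSections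
open AlgebraicGeometry.Scheme.IdealSheafData

namespace Summit.ResolutionOfSingularities.ResolutionOfSingularities.Cruxes.EquisingularLiftNat.Sections

namespace KeyForm

/-! ## §1 The dehomogenisation ring homomorphism `Dᵢ : O[x] → Γ(ℙ_O, D₊(xᵢ))` -/

section Dehom

variable {O : Type} [CommRing O] {N : ℕ} (i : Fin (N + 1))

/-- **Dehomogenisation is a ring homomorphism on ALL of `O[x]`** and agrees with `F ↦ awayToSection (F / xᵢ^d)` on forms of degree `d`
(Literature `Segre.awayMk_eq_eval₂`). [cite: Hartshorne1977, II Prop. 2.5 (proof)] -/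
theorem awayToSection_mk₁_eq_dehom (d : ℕ) (F : MvPolynomial (Fin (N + 1)) O) (hF : F ∈ homogeneousSubmodule (Fin (N + 1)) O d) :
    letI := MvPolynomial.gradedAlgebra (σ := Fin (N + 1)) (R := O)
    (Proj.awayToSection (homogeneousSubmodule (Fin (N + 1)) O) (X i)).hom
        (mk₁ (homogeneousSubmodule (Fin (N + 1)) O) (CILift.X_mem_one' i) d F hF) =
      ((Proj.awayToSection (homogeneousSubmodule (Fin (N + 1)) O) (X i)).hom.comp
        (eval₂Hom (cst O (X i)) (frac O i))) F := by
  letI := MvPolynomial.gradedAlgebra (σ := Fin (N + 1)) (R := O)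
  rw [RingHom.comp_apply, mk₁]
  congr 1
  exact awayMk_eq_eval₂ (k := O) i d F _

end Dehom

/-! ## §2 The section's point generators lie in `ker s` on every chart -/

section Point

variable {O : Type} [CommRing O] {N : ℕ}

/-- The point generators `x_j − a_j x_{i₀}` are linear forms. [folklore] -/
theorem pointGen_mem (i₀ : Fin (N + 1)) (a : Fin (N + 1) → O) (j : Fin (N + 1)) :
    (X j - C (a j) * X i₀ : MvPolynomial (Fin (N + 1)) O) ∈ homogeneousSubmodule (Fin (N + 1)) O 1 := by
  refine (mem_homogeneousSubmodule _ _).mpr ((isHomogeneous_X O j).sub ?_)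
  simpa using (isHomogeneous_C (Fin (N + 1)) (a j)).mul (isHomogeneous_X O i₀)

/-- **`𝔓~ ≤ ker s`**: the ideal sheaf of the section's homogeneous ideal `𝔓 = (x_j − a_j x_{i₀})_j` is contained in the kernel of the section —
its pull-back to `Spec O` vanishes, since over the chart `D₊(x_{i₀}) ⊇ s(Spec O)` it is generated by the `Φ((x_j − a_j x_{i₀})/x_{i₀}) = a_j − a_j · 1 = 0`
(✓ `LinearLetter.sectionPull_awayMk`, `coord_self`). [folklore] -/
theorem projIdealSheaf_pointGens_le_ker :
    letI := MvPolynomial.gradedAlgebra (σ := Fin (N + 1)) (R := O)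
    ∀ (s : Spec (.of O) ⟶ Proj (homogeneousSubmodule (Fin (N + 1)) O))
    (i₀ : Fin (N + 1)) (htop : (⊤ : (Spec (.of O)).Opens) ≤ preU s i₀)
    (Φ : Away (homogeneousSubmodule (Fin (N + 1)) O) (X i₀) →+* Γ(Spec (.of O), ⊤))
    (_hΦs : ∀ c, s.appLE (Proj.basicOpen (homogeneousSubmodule (Fin (N + 1)) O) (X i₀)) ⊤ htop
      (Proj.awayToSection (homogeneousSubmodule (Fin (N + 1)) O) (X i₀) c) = Φ c)
    (_hΦcst : ∀ c : O, Φ (cst O (X i₀) c) = (Scheme.ΓSpecIso (.of O)).inv c)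
    (a : Fin (N + 1) → O) (_ha : ∀ j, a j = (Scheme.ΓSpecIso (.of O)).hom (Φ (frac O i₀ j))),
    projIdealSheaf (homogeneousSubmodule (Fin (N + 1)) O)
        ⟨Ideal.span (Set.range fun j : Fin (N + 1) => (X j - C (a j) * X i₀ : MvPolynomial (Fin (N + 1)) O)),
          isHomogeneous_span_of_forall_mem _ _ (fun _ => 1) (pointGen_mem i₀ a)⟩ ≤ s.ker := by
  letI := MvPolynomial.gradedAlgebra (σ := Fin (N + 1)) (R := O)
  intro s i₀ htop Φ hΦs hΦcst a ha
  -- adapted from `LinearLetter.ker_projMap_le_ker_of_eval_eq_zero` (…NatHyperplaneLetterThroughSection)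
  rw [← Scheme.IdealSheafData.map_bot s, Scheme.IdealSheafData.le_map_iff_comap_le, le_bot_iff]
  let V : (Spec (.of O)).affineOpens := ⟨⊤, isAffineOpen_top (Spec (.of O))⟩
  have hV : ⨆ _ : Unit, (V : (Spec (.of O)).Opens) = ⊤ := by simp [V]
  refine le_bot_iff.mp (le_of_iSup_eq_top (fun _ : Unit => V) hV fun _ => ?_)
  rw [Scheme.IdealSheafData.ideal_bot, Pi.bot_apply, le_bot_iff,
    ideal_comap_of_le s _ ⟨Proj.basicOpen (homogeneousSubmodule (Fin (N + 1)) O) (X i₀),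
      Proj.isAffineOpen_basicOpen _ (X i₀) (CILift.X_mem_one' i₀) one_pos⟩ V htop,
    projIdealSheaf_ideal_basicOpen_span _ _ (fun _ => 1) (pointGen_mem i₀ a) _ (CILift.X_mem_one' i₀), Ideal.map_span,
    ← Set.range_comp, Ideal.span_eq_bot]
  rintro _ ⟨j, rfl⟩
  change s.appLE _ ⊤ htop _ = 0
  rw [hΦs, mk₁, LinearLetter.sectionPull_awayMk i₀ Φ hΦcst 1 _]
  have ha0 : a i₀ = 1 := (ha i₀).trans (LinearLetter.coord_self i₀ Φ)
  have h0 : MvPolynomial.eval (fun j => (Scheme.ΓSpecIso (.of O)).hom (Φ (frac O i₀ j))) (X j - C (a j) * X i₀) = 0 := by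
    simp only [map_sub, map_mul, eval_X, eval_C, ← ha, ha0, mul_one, sub_self]
  rw [h0, map_zero]

/-- **On EVERY chart `D₊(xᵢ)` the dehomogenised point generators lie in the section's kernel**: `Dᵢ (x_j − a_j x_{i₀}) ∈ (ker s)(D₊(xᵢ))`. [folklore] -/
theorem dehom_pointGen_mem_ker_ideal :
    letI := MvPolynomial.gradedAlgebra (σ := Fin (N + 1)) (R := O)
    ∀ (s : Spec (.of O) ⟶ Proj (homogeneousSubmodule (Fin (N + 1)) O))
    (i₀ : Fin (N + 1)) (htop : (⊤ : (Spec (.of O)).Opens) ≤ preU s i₀)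
    (Φ : Away (homogeneousSubmodule (Fin (N + 1)) O) (X i₀) →+* Γ(Spec (.of O), ⊤))
    (_hΦs : ∀ c, s.appLE (Proj.basicOpen (homogeneousSubmodule (Fin (N + 1)) O) (X i₀)) ⊤ htop
      (Proj.awayToSection (homogeneousSubmodule (Fin (N + 1)) O) (X i₀) c) = Φ c)
    (_hΦcst : ∀ c : O, Φ (cst O (X i₀) c) = (Scheme.ΓSpecIso (.of O)).inv c)
    (a : Fin (N + 1) → O) (_ha : ∀ j, a j = (Scheme.ΓSpecIso (.of O)).hom (Φ (frac O i₀ j))) (i j : Fin (N + 1)),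
    ((Proj.awayToSection (homogeneousSubmodule (Fin (N + 1)) O) (X i)).hom.comp (eval₂Hom (cst O (X i)) (frac O i)))
        (X j - C (a j) * X i₀) ∈
      s.ker.ideal ⟨Proj.basicOpen (homogeneousSubmodule (Fin (N + 1)) O) (X i),
        Proj.isAffineOpen_basicOpen _ (X i) (CILift.X_mem_one' i) one_pos⟩ := by
  letI := MvPolynomial.gradedAlgebra (σ := Fin (N + 1)) (R := O)
  intro s i₀ htop Φ hΦs hΦcst a ha i j
  have hle := projIdealSheaf_pointGens_le_ker s i₀ htop Φ hΦs hΦcst a ha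
    ⟨Proj.basicOpen (homogeneousSubmodule (Fin (N + 1)) O) (X i), Proj.isAffineOpen_basicOpen _ (X i) (CILift.X_mem_one' i) one_pos⟩
  rw [projIdealSheaf_ideal_basicOpen_span _ _ (fun _ => 1) (pointGen_mem i₀ a) _ (CILift.X_mem_one' i)] at hle
  rw [← awayToSection_mk₁_eq_dehom i 1 _ (pointGen_mem i₀ a j)]
  exact hle (Ideal.subset_span ⟨j, rfl⟩)

end Point

/-! ## §3 ★ (B5) The gauge membership upstairs -/

section Gauge

set_option maxHeartbeats 400000 in
/-- ★ **(B5) THE GAUGE MEMBERSHIP UPSTAIRS** (res-L1-w45b-stub-4's `KeyFormSIG.lean`, VERBATIM up to the names of unused binders): from the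
polynomial membership `Gt ∈ (Lh^α) + (Lh)·𝔓^α + 𝔓^α·(Lj)` to the ideal-sheaf inequality
`(Gt)~ ≤ (ker Proj fh)^α ⊔ (ker Proj fh) · (ker s)^α ⊔ (ker s)^α · (ker Proj fj)` on `ℙ^{r+1}_O`, for letter models with `ker fh = (Lh)`,
`ker fj = (Lj)`. [cite: Hartshorne1977, II Prop. 5.9, Ex. 3.12] [OURS · L1 W4.5b · D5 HOPEN (IN-1) brick (B5)] -/
theorem keyModel_le_gauge (O : Type) [CommRing O] [IsDomain O] [IsDiscreteValuationRing O] {r : ℕ} :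
    letI := MvPolynomial.gradedAlgebra (σ := Fin (r + 1 + 1)) (R := O)
    letI := MvPolynomial.gradedAlgebra (σ := Fin (r + 1)) (R := O)
    ∀ (s : Spec (.of O) ⟶ Proj (homogeneousSubmodule (Fin (r + 1 + 1)) O))
    (_hs : s ≫ (Proj.toSpecZero (homogeneousSubmodule (Fin (r + 1 + 1)) O) ≫
      Spec.map (CommRingCat.ofHom (algebraMap O ((homogeneousSubmodule (Fin (r + 1 + 1)) O) 0)))) = 𝟙 _)
    (i₀ : Fin (r + 1 + 1)) (htop : (⊤ : (Spec (.of O)).Opens) ≤ preU s i₀)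
    (Φ : Away (homogeneousSubmodule (Fin (r + 1 + 1)) O) (X i₀) →+* Γ(Spec (.of O), ⊤))
    (hΦs : ∀ c, s.appLE (Proj.basicOpen (homogeneousSubmodule (Fin (r + 1 + 1)) O) (X i₀)) ⊤ htop
      (Proj.awayToSection (homogeneousSubmodule (Fin (r + 1 + 1)) O) (X i₀) c) = Φ c)
    (hΦcst : ∀ c : O, Φ (cst O (X i₀) c) = (Scheme.ΓSpecIso (.of O)).inv c)
    (a : Fin (r + 1 + 1) → O) (ha : ∀ j, a j = (Scheme.ΓSpecIso (.of O)).hom (Φ (frac O i₀ j)))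
    -- the two letters' models (part 3 currency)
    (Lh Lj : MvPolynomial (Fin (r + 1 + 1)) O) (hLh : Lh.IsHomogeneous 1) (hLj : Lj.IsHomogeneous 1)
    (jh jj : Fin (r + 1 + 1))
    (fh : (homogeneousSubmodule (Fin (r + 1 + 1)) O) →+*ᵍ (homogeneousSubmodule (Fin (r + 1)) O))
    (hfh' : HomogeneousIdeal.irrelevant (homogeneousSubmodule (Fin (r + 1)) O) ≤ (HomogeneousIdeal.irrelevant (homogeneousSubmodule (Fin (r + 1 + 1)) O)).map fh)
    (hfhC : ∀ b : O, fh (C b) = C b) (hfhe : ∀ j : Fin (r + 1), fh (X (Fin.succAbove jh j)) = X j) (hkerh : RingHom.ker fh = Ideal.span {Lh})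
    (fj : (homogeneousSubmodule (Fin (r + 1 + 1)) O) →+*ᵍ (homogeneousSubmodule (Fin (r + 1)) O))
    (hfj' : HomogeneousIdeal.irrelevant (homogeneousSubmodule (Fin (r + 1)) O) ≤ (HomogeneousIdeal.irrelevant (homogeneousSubmodule (Fin (r + 1 + 1)) O)).map fj)
    (hfjC : ∀ b : O, fj (C b) = C b) (hfje : ∀ j : Fin (r + 1), fj (X (Fin.succAbove jj j)) = X j) (hkerj : RingHom.ker fj = Ideal.span {Lj})
    -- the key form and its polynomial membership
    (Gt : MvPolynomial (Fin (r + 1 + 1)) O) (e α : ℕ) (hGt : Gt ∈ homogeneousSubmodule (Fin (r + 1 + 1)) O e)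
    (hmem : Gt ∈ Ideal.span {Lh ^ α} ⊔ Ideal.span {Lh} * Ideal.span (Set.range fun j : Fin (r + 1 + 1) => X j - C (a j) * X i₀) ^ α ⊔
        Ideal.span (Set.range fun j : Fin (r + 1 + 1) => X j - C (a j) * X i₀) ^ α * Ideal.span {Lj}),
    projIdealSheaf (homogeneousSubmodule (Fin (r + 1 + 1)) O)
        ⟨Ideal.span (Set.range fun _ : Fin 1 => Gt), isHomogeneous_span_of_forall_mem _ (fun _ : Fin 1 => Gt) (fun _ => e) (fun _ => hGt)⟩ ≤
      (Proj.map fh hfh').ker ^ α ⊔ (Proj.map fh hfh').ker * s.ker ^ α ⊔ s.ker ^ α * (Proj.map fj hfj').ker := by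
  letI := MvPolynomial.gradedAlgebra (σ := Fin (r + 1 + 1)) (R := O)
  letI := MvPolynomial.gradedAlgebra (σ := Fin (r + 1)) (R := O)
  intro s _ i₀ htop Φ hΦs hΦcst a ha Lh Lj hLh hLj jh jj fh hfh' hfhC hfhe hkerh fj hfj' hfjC hfje hkerj Gt e α hGt hmem
  classical
  refine Scheme.IdealSheafData.le_of_iSup_eq_top
    (fun i : Fin (r + 1 + 1) => (⟨Proj.basicOpen (homogeneousSubmodule (Fin (r + 1 + 1)) O) (X i),
      Proj.isAffineOpen_basicOpen (homogeneousSubmodule (Fin (r + 1 + 1)) O) (X i) (CILift.X_mem_one' i) one_pos⟩ :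
        (Proj (homogeneousSubmodule (Fin (r + 1 + 1)) O)).affineOpens)) (SatLift.iSup_chart_eq_top O (r + 1)) fun i => ?_
  -- the dehomogenisation ring homomorphism of the chart `D₊(xᵢ)`
  set D : MvPolynomial (Fin (r + 1 + 1)) O →+* Γ(Proj (homogeneousSubmodule (Fin (r + 1 + 1)) O),
      Proj.basicOpen (homogeneousSubmodule (Fin (r + 1 + 1)) O) (X i)) :=
    (Proj.awayToSection (homogeneousSubmodule (Fin (r + 1 + 1)) O) (X i)).hom.comp (eval₂Hom (cst O (X i)) (frac O i)) with hD
  -- chart ideals: the key model, the two letters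
  rw [projIdealSheaf_ideal_basicOpen_span _ (fun _ : Fin 1 => Gt) (fun _ => e) (fun _ => hGt) _ (CILift.X_mem_one' i), Set.range_const,
    awayToSection_mk₁_eq_dehom i e Gt hGt, ← hD, Ideal.span_singleton_le_iff_mem]
  have hKh : (Proj.map fh hfh').ker.ideal ⟨Proj.basicOpen (homogeneousSubmodule (Fin (r + 1 + 1)) O) (X i),
      Proj.isAffineOpen_basicOpen (homogeneousSubmodule (Fin (r + 1 + 1)) O) (X i) (CILift.X_mem_one' i) one_pos⟩ = Ideal.span {D Lh} := by
    rw [LinearLetter.ideal_ker_basicOpen_eq_span (Fin.succAbove jh) fh hfh' hfhC hfhe i hLh hkerh, awayMk_eq_eval₂, hD,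
      RingHom.comp_apply]
  have hKj : (Proj.map fj hfj').ker.ideal ⟨Proj.basicOpen (homogeneousSubmodule (Fin (r + 1 + 1)) O) (X i),
      Proj.isAffineOpen_basicOpen (homogeneousSubmodule (Fin (r + 1 + 1)) O) (X i) (CILift.X_mem_one' i) one_pos⟩ = Ideal.span {D Lj} := by
    rw [LinearLetter.ideal_ker_basicOpen_eq_span (Fin.succAbove jj) fj hfj' hfjC hfje i hLj hkerj, awayMk_eq_eval₂, hD,
      RingHom.comp_apply]
  -- the point generators on this chart
  have hP : Ideal.span (Set.range (D ∘ fun j : Fin (r + 1 + 1) => X j - C (a j) * X i₀)) ≤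
      s.ker.ideal ⟨Proj.basicOpen (homogeneousSubmodule (Fin (r + 1 + 1)) O) (X i),
        Proj.isAffineOpen_basicOpen (homogeneousSubmodule (Fin (r + 1 + 1)) O) (X i) (CILift.X_mem_one' i) one_pos⟩ := by
    rw [Ideal.span_le]
    rintro _ ⟨j, rfl⟩
    rw [Function.comp_apply, hD]
    exact dehom_pointGen_mem_ker_ideal s i₀ htop Φ hΦs hΦcst a ha i j
  -- push the polynomial membership through `D`
  have hDmem := Ideal.mem_map_of_mem D hmem
  simp only [Ideal.map_sup, Ideal.map_mul, Ideal.map_pow, Ideal.map_span, Set.image_singleton, ← Set.range_comp, map_pow] at hDmem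
  rw [← Ideal.span_singleton_pow] at hDmem
  -- compare summand by summand
  simp only [Scheme.IdealSheafData.ideal_sup, Scheme.IdealSheafData.ideal_mul, Scheme.IdealSheafData.ideal_pow, Pi.sup_apply,
    Pi.mul_apply, Pi.pow_apply]
  rw [hKh, hKj]
  exact sup_le_sup (sup_le_sup le_rfl (Ideal.mul_mono le_rfl (Ideal.pow_right_mono hP α)))
    (Ideal.mul_mono (Ideal.pow_right_mono hP α) le_rfl) hDmem

end Gauge

end KeyForm

end Summit.ResolutionOfSingularities.ResolutionOfSingularities.Cruxes.EquisingularLiftNat.Sections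

end
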